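import Summits.RiemannHypothesis.RiemannHypothesis.Theorems.JensenLogBandArcShiftModelLogDeriv
import Summits.RiemannHypothesis.RiemannHypothesis.Theorems.JensenLogBandArcSaddleSharp
import Summits.RiemannHypothesis.RiemannHypothesis.Theorems.JensenLogBandArcDescent
import HarnessLib

/-!
# The φ-density has log-derivative `S`; the shifted model has `Re M̃′/M̃(v₀) ≥ ℓ_T/2 − 14 − 1/δ`

RH ladder column JENSEN, rung J-P(P3) «log band», BAND crux `XiDerivBandRealAllRates` of route
«JensenLogBand», line «band-one-window» (u-arc, top-shell reshape), lead rh-jensen-prover g8 — two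
near-zone inputs complementing eng-2 g6's `Theorems/JensenLogBandArcShiftModelLogDeriv.lean` (p502058).
RH-FREE. WHAT THIS IS NOT: nothing here bears on zeros of `ζ` off the line or the truth of RH.

* `hasDerivAt_arcDensity` / `arcDensity_ne_zero`: the φ-density `P_{n,c}(u) = (u−c)γ̃(½+u)K_{n,c}(u)`
  (`LogBandArc.arcDensity`) satisfies `dP/du = P·S_{n,c}` at every good point — the input of the
  segment representation `P(u*) = P(ũ)·exp((u*−ũ)∫₀¹S)` in the model comparison [CMP];
* `re_logDeriv_arcShiftModel_centre_ge_ell`: in regime R2 with the window right of `1 + δ`,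
  eng-2's `re_logDeriv_arcShiftModel_centre_ge` in the clean form `Re M̃′/M̃(v₀) ≥ ℓ_T/2 − 14 − 1/δ`
  (bookkeeping `n(h−ε)/(h+ε)² ≥ n(1−3ε/h)/h ≥ ℓ_T/2 − 13`, `hℓ_T = 2(n+1)`, `ε = (2+16h/5)/ℓ_T`).
-/

noncomputable section

-- single-problem summit: `Summit.RiemannHypothesis.RiemannHypothesis.…` is the tree convention
set_option linter.dupNamespace false

open Complex Real Set Metric

namespace Summit.RiemannHypothesis.RiemannHypothesis.Theorems.JensenPolynomials.LogBandArc

open Literature.NumberTheory.LFunctions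

/-! ## The φ-density: derivative and non-vanishing -/

/-- The φ-density does not vanish at a point with `Re(½+u) > 0`, `½+u ≠ 1`, `u ≠ 0`, `u ≠ ±c`.
[folklore] -/
theorem arcDensity_ne_zero (n : ℕ) {c u : ℂ} (hre : 0 < (1 / 2 + u).re) (h1 : 1 / 2 + u ≠ 1)
    (hu0 : u ≠ 0) (huc : u ≠ c) (hupc : u + c ≠ 0) : arcDensity n c u ≠ 0 := by
  have hD : u ^ 2 - c ^ 2 ≠ 0 := by
    have : u ^ 2 - c ^ 2 = (u - c) * (u + c) := by ring
    rw [this]; exact mul_ne_zero (sub_ne_zero.2 huc) hupc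
  unfold arcDensity sqKernel
  refine mul_ne_zero (sub_ne_zero.2 huc) (mul_ne_zero (xiGammaFactor_ne_zero hre h1) ?_)
  exact mul_ne_zero (mul_ne_zero two_ne_zero hu0) (inv_ne_zero (pow_ne_zero _ hD))

/-- **`dP/du = P · S`**: the φ-density `P_{n,c}(u) = (u−c)γ̃(½+u)K_{n,c}(u)` has logarithmic derivative
`arcSaddleFn n c u` at every good point. [folklore] -/
theorem hasDerivAt_arcDensity (n : ℕ) {c u : ℂ} (hre : 0 < (1 / 2 + u).re) (h1 : 1 / 2 + u ≠ 1)
    (hu0 : u ≠ 0) (huc : u ≠ c) (hupc : u + c ≠ 0) :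
    HasDerivAt (arcDensity n c) (arcDensity n c u * arcSaddleFn n c u) u := by
  have huc' : u - c ≠ 0 := sub_ne_zero.2 huc
  have hD : u ^ 2 - c ^ 2 ≠ 0 := by
    have : u ^ 2 - c ^ 2 = (u - c) * (u + c) := by ring
    rw [this]; exact mul_ne_zero huc' hupc
  have hDn : (u ^ 2 - c ^ 2) ^ (n + 1) ≠ 0 := pow_ne_zero _ hD
  set G : ℂ := xiGammaFactor (1 / 2 + u) with hG
  set L : ℂ := logDeriv xiGammaFactor (1 / 2 + u) with hL
  have hG0 : G ≠ 0 := xiGammaFactor_ne_zero hre h1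
  -- (1) `u ↦ u − c`
  have hd1 : HasDerivAt (fun w : ℂ => w - c) 1 u := (hasDerivAt_id u).sub_const c
  -- (2) `u ↦ γ̃(½+u)`, derivative `L·G`
  have hderivG : deriv xiGammaFactor (1 / 2 + u) = L * G := by
    have h0 := div_mul_cancel₀ (deriv xiGammaFactor (1 / 2 + u)) hG0
    rw [hL, logDeriv_apply]
    exact h0.symm
  have hd2 : HasDerivAt (fun w : ℂ => xiGammaFactor (1 / 2 + w)) (L * G) u := by
    have hin : HasDerivAt (fun w : ℂ => (1 / 2 : ℂ) + w) 1 u := (hasDerivAt_id u).const_add _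
    have hout : HasDerivAt xiGammaFactor (deriv xiGammaFactor (1 / 2 + u)) (1 / 2 + u) :=
      (differentiableAt_xiGammaFactor hre).hasDerivAt
    have h := hout.comp u hin
    rw [hderivG, mul_one] at h
    exact h
  -- (3) the kernel
  have hd3 := hasDerivAt_sqKernel_point n c hD
  -- assemble
  have hprod := hd1.fun_mul (hd2.fun_mul hd3)
  have efun : arcDensity n c = fun w : ℂ => (w - c) * (xiGammaFactor (1 / 2 + w) * sqKernel n c w) := by
    funext w; rw [arcDensity]
  rw [efun]
  refine hprod.congr_deriv ?_
  beta_reduce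
  rw [arcSaddleFn]
  simp only [← hG, ← hL, sqKernel]
  field_simp
  ring

/-- `(1 − t)/(1 + t)² ≥ 1 − 3t` for `t ≥ 0`. [folklore] -/
theorem one_sub_div_sq_ge {t : ℝ} (ht : 0 ≤ t) : 1 - 3 * t ≤ (1 - t) / (1 + t) ^ 2 := by
  rw [le_div_iff₀ (by positivity)]
  nlinarith [sq_nonneg t, mul_nonneg ht (sq_nonneg t)]

/-- The bookkeeping behind `Re M̃′/M̃ ≥ ℓ/2 − 13`: with `hℓ = 2(n+1)`, `ε = (2+16h/5)/ℓ`, `h ≥ ½`,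
`ℓ ≥ 20` and `A ≥ (1 − 3ε/h)/h`, one has `n·A ≥ ℓ/2 − 13`. [folklore] -/
theorem saddle_logDeriv_bookkeeping {h ℓ ε A : ℝ} {n : ℕ} (hh : 1 / 2 ≤ h) (hℓ : 20 ≤ ℓ)
    (hhℓ : h * ℓ = 2 * ((n : ℝ) + 1)) (hε : ε = (2 + 16 / 5 * h) / ℓ)
    (hA : (1 - 3 * (ε / h)) / h ≤ A) : ℓ / 2 - 13 ≤ (n : ℝ) * A := by
  have hh0 : 0 < h := by linarith
  have hℓ0 : 0 < ℓ := by linarith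
  have hn0 : (0 : ℝ) ≤ n := Nat.cast_nonneg n
  have hε0 : 0 ≤ ε := by rw [hε]; positivity
  -- `n/h = ℓ/2 − 1/h ≥ ℓ/2 − 2`
  have h1 : (n : ℝ) / h = ℓ / 2 - 1 / h := by
    rw [eq_sub_iff_add_eq, ← add_div, div_eq_iff hh0.ne']; linarith
  have h2 : 1 / h ≤ 2 := by rw [div_le_iff₀ hh0]; linarith
  -- `ε/h ≤ 7.2/ℓ`
  have h3 : ε / h ≤ 36 / 5 / ℓ := by
    have h3a : ε / h = (2 / h + 16 / 5) / ℓ := by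
      rw [hε]; field_simp
    have h3b : 2 / h ≤ 4 := by rw [div_le_iff₀ hh0]; linarith
    rw [h3a]
    exact div_le_div_of_nonneg_right (by linarith) hℓ0.le
  have h4 : (n : ℝ) / h ≤ ℓ / 2 := by
    rw [h1]; have := one_div_pos.2 hh0; linarith
  have h5 : 3 * ((n : ℝ) / h) * (ε / h) ≤ 54 / 5 := by
    calc 3 * ((n : ℝ) / h) * (ε / h) ≤ 3 * (ℓ / 2) * (36 / 5 / ℓ) := by
          apply mul_le_mul (by linarith) h3 (div_nonneg hε0 hh0.le) (by positivity)
      _ = 54 / 5 := by field_simp; ring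
  have h6 : (n : ℝ) * ((1 - 3 * (ε / h)) / h) = (n : ℝ) / h - 3 * ((n : ℝ) / h) * (ε / h) := by
    field_simp
  have h7 : (n : ℝ) * ((1 - 3 * (ε / h)) / h) ≤ (n : ℝ) * A := mul_le_mul_of_nonneg_left hA hn0
  rw [h6] at h7
  linarith

variable {n : ℕ} {x T : ℝ} {ustar : ℂ}

/-- **`Re M̃′/M̃(v₀) ≥ ℓ_T/2 − 14 − 1/δ`** in regime R2 (`h ≤ 20`) when the saddle window is right of
`1 + δ` (clean form of eng-2 g6's `re_logDeriv_arcShiftModel_centre_ge`). [folklore] -/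
theorem re_logDeriv_arcShiftModel_centre_ge_ell (hx : |x| ≤ 1 / 2) (hT : 100 ≤ T) (hℓ : 20 ≤ ell T)
    (hn : 100 ≤ n) (hh : 1 / 2 ≤ bandRadius n T) (hhT : bandRadius n T ≤ 7 / 20 * T)
    (hH : bandRadius n T ≤ 20)
    (hustar : ‖ustar - ((x : ℂ) + (T : ℂ) * I + bandRadius n T)‖ ≤ 3 / 5 * bandRadius n T)
    (hS : arcSaddleFn n ((x : ℂ) + (T : ℂ) * I) ustar = 0) {δ : ℝ} (hδ : 0 < δ)
    (hδσ : 1 + δ ≤ (1 / 2 + ustar).re)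
    (hM : arcShiftModel n ((x : ℂ) + (T : ℂ) * I) ustar ((x : ℂ) + (T : ℂ) * I) ≠ 0) :
    ell T / 2 - 14 - 1 / δ ≤
      (deriv (arcShiftModel n ((x : ℂ) + (T : ℂ) * I) ustar) ((x : ℂ) + (T : ℂ) * I) /
        arcShiftModel n ((x : ℂ) + (T : ℂ) * I) ustar ((x : ℂ) + (T : ℂ) * I)).re := by
  have hσ : 1 < (1 / 2 + ustar).re := by linarith
  have h0 := re_logDeriv_arcShiftModel_centre_ge hx hT hℓ hn hh hhT hH hustar hS hσ hM
  set h : ℝ := bandRadius n T with hhdef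
  set ℓ : ℝ := ell T with hℓdef
  set ε : ℝ := (2 + 16 / 5 * h) / ℓ with hε
  have hℓ0 : 0 < ℓ := by rw [hℓdef]; linarith
  have hh0 : 0 < h := by rw [hhdef]; linarith
  have hhℓ : h * ℓ = 2 * ((n : ℝ) + 1) := bandRadius_mul_ell hℓ
  obtain ⟨-, hεh, -, -, -⟩ := R2_bookkeeping (n := n) hT hℓ hh hH
  rw [← hhdef, ← hℓdef, ← hε] at hεh
  have hε0 : 0 ≤ ε := by rw [hε]; positivity
  -- `(h − ε)/(h + ε)² ≥ (1 − 3ε/h)/h`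
  have hkey : (1 - 3 * (ε / h)) / h ≤ (h - ε) / (h + ε) ^ 2 := by
    have ht : 0 ≤ ε / h := div_nonneg hε0 hh0.le
    have h5 := one_sub_div_sq_ge ht
    have h6 : (h - ε) / (h + ε) ^ 2 = ((1 - ε / h) / (1 + ε / h) ^ 2) / h := by
      field_simp
    rw [h6]
    exact div_le_div_of_nonneg_right h5 hh0.le
  have hmain : ℓ / 2 - 13 ≤ (n : ℝ) * ((h - ε) / (h + ε) ^ 2) :=
    saddle_logDeriv_bookkeeping hh hℓ hhℓ hε hkey
  have hz : 1 / ((1 / 2 + ustar).re - 1) ≤ 1 / δ := one_div_le_one_div_of_le hδ (by linarith)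
  have h0' : (n : ℝ) * ((h - ε) / (h + ε) ^ 2) - 1 / 10 - 1 / ((1 / 2 + ustar).re - 1) ≤
      (deriv (arcShiftModel n ((x : ℂ) + (T : ℂ) * I) ustar) ((x : ℂ) + (T : ℂ) * I) /
        arcShiftModel n ((x : ℂ) + (T : ℂ) * I) ustar ((x : ℂ) + (T : ℂ) * I)).re := h0
  linarith

end Summit.RiemannHypothesis.RiemannHypothesis.Theorems.JensenPolynomials.LogBandArc

end
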